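import Literature.Analysis.FluidPDE.BiotSavartRepresentationSqIntegrable
import Literature.Analysis.FluidPDE.BiotSavartCurlGradient
import HarnessLib

/-!
# Crux `Target` (stmt-NavierStokesRegularity-1217), line `depletion_ladder`, stub S1 (registered class):
# tools for the Biot–Savart representation modulo constants of BOUNDED fields

`--supports stmt-NavierStokesRegularity-1217` (seat leafhand-ns-poloidalwindowdoor-3 g0, cell decomp-ns; step
(P1) "representation" of the registered-class programme for `stub_depletionBelowHalf`; the theorem
itself is `…BoundedBiotSavart.exists_eq_const_add_biotSavart_curl` in the companion file
`TargetDepletionLadderBoundedBiotSavart.lean`, which imports this one).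

The registered stub S1 quantifies over `C²` divergence-free fields `u : ℝ³ → ℝ³` that are merely
BOUNDED (`‖u‖ ≤ M`, no decay) with square-integrable vorticity; the tree's representation theorem
`biotSavart_curl_eq_self_of_lintegral_sq_lt_top` (`K₃ ∗ curl v = v`) needs `v ∈ L²`. For bounded `v`
the Helmholtz projection is defined up to an additive constant, and the proof of that needs the
following three tools, all read off the tree's Biot–Savart / singular-kernel files:

* `eq_biotSavart_curl_suppCutoff_smul_add_of_norm_sub_le` — the tree's **local Helmholtz identity at
  scale `ρ`** (`eq_biotSavart_curl_suppCutoff_smul_add`, Majda–Bertozzi §2.4.1 (2.92)–(2.95)) read off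
  at ANY point `x` of the ball `B̄(x₀, ρ)` on which the cutoff `φ = suppCutoff x₀ ρ` equals `1` (the
  tree states it at the centre `x = x₀` only; same proof, the centre decoupled from the point):
  `v(x) = (K₃ ∗ curl(φv))(x) + ∑ⱼ (∫ ∂ⱼΓ(x − y) ⟪v(y), ∇φ(y)⟫ dy) eⱼ`.
* `norm_kernel_sub_kernel_apply_shell_le`, `norm_integral_kernel_sub_kernel_apply_shell_le` — for a
  `C¹` singular kernel `K` of degree `−2` (`IsC1SingularKernel K A`: `K₃` and `∂Γ` are instances,
  `exists_isC1SingularKernel_biotSavartCLM`, `exists_isC1SingularKernel_fderiv_newtonKernel`) and a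
  density `g` bounded by `M‖∇φ(y)‖` for the cutoff `φ = suppCutoff ξ ρ` centred at the midpoint `ξ` of
  two points `x, x̄` with `‖x − x̄‖ ≤ ρ` (so `g` lives on the shell `ρ ≤ |y − ξ| ≤ 2ρ`, where the
  tree's mean value bound `norm_kernel_sub_kernel_le` gives `‖K(x − y) − K(x̄ − y)‖ ≤ 8A‖x − x̄‖ρ⁻³`
  and `‖∇φ‖ ≤ Bρ⁻¹`): pointwise `‖(K(x − y) − K(x̄ − y)) g(y)‖ ≤ 8A‖x − x̄‖BMρ⁻⁴ 1_{B̄(ξ,2ρ)}(y)`, and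
  integrated `‖∫ (K(x − y) − K(x̄ − y)) g(y) dy‖ ≤ 64 A B M |B₁| ‖x − x̄‖ ρ⁻¹`.
* `integrable_norm_mul_inv_sq` (the `C ∩ L²` majorant `(4π)⁻¹‖ω(y)‖|x − y|⁻² ∈ L¹`, private in the
  tree's `BiotSavartRepresentationSqIntegrable`) and `tendsto_integral_biotSavartKernel_suppCutoff_smul`
  — for `ω ∈ C ∩ L²`, any centre `ξ`, point `z` and scales `ρₙ ≥ n + 1`,
  `∫ K₃(z − y) φₙ(y) ω(y) dy → (K₃ ∗ ω)(z)` (dominated convergence).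

HONEST LABEL: helper tools (step P1 of an L/XL programme); closes no stub; no Navier–Stokes content;
`Target`, S3 and NS regularity remain OPEN.

References: A. J. Majda, A. L. Bertozzi, *Vorticity and Incompressible Flow* (CUP 2002), §2.4.1
Prop. 2.16, (2.92)–(2.95), §4.1.3 (4.30)–(4.31); D. Gilbarg, N. S. Trudinger (2001), §4.1
Lemmas 4.1–4.2. [folklore]
-/

noncomputable section

-- the summit and its single sub-problem share the name (CONVENTIONS §1)
set_option linter.dupNamespace false

open MeasureTheory Set Function Filter Metric Real InnerProductSpace Topology
open scoped ENNReal NNReal RealInnerProductSpace Laplacian ContDiff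
open Literature.Analysis.FluidPDE

namespace Summit.NavierStokesRegularity.NavierStokesRegularity.Theorems.DepletionLadder.BoundedBiotSavart

/-! ### The local Helmholtz identity at scale `ρ`, read off at any point of the inner ball -/

section Representation

variable {v : (EuclideanSpace ℝ (Fin 3)) → (EuclideanSpace ℝ (Fin 3))}

/-- The gradient of the scale-`ρ` cutoff is `C¹`. [folklore] -/
theorem contDiff_gradient_suppCutoff_scale (x : (EuclideanSpace ℝ (Fin 3))) (ρ : ℝ) :
    ContDiff ℝ 1 (gradient (suppCutoff x ρ)) :=
  (InnerProductSpace.toDual ℝ (EuclideanSpace ℝ (Fin 3))).symm.contDiff.comp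
    ((contDiff_suppCutoff x ρ (n := 2)).fderiv_right (m := 1) (by norm_cast))

/-- The gradient of the scale-`ρ` cutoff has compact support. [folklore] -/
theorem hasCompactSupport_gradient_suppCutoff_scale (x : (EuclideanSpace ℝ (Fin 3))) {ρ : ℝ}
    (hρ : 0 < ρ) : HasCompactSupport (gradient (suppCutoff x ρ)) :=
  ((hasCompactSupport_suppCutoff x hρ).fderiv (𝕜 := ℝ)).comp_left
    (g := (InnerProductSpace.toDual ℝ (EuclideanSpace ℝ (Fin 3))).symm) (map_zero _)

/-- **The local Helmholtz identity at scale `ρ`, at any point of the inner ball.** For a `C²`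
divergence-free field `v`, `ρ > 0`, the smooth cutoff `φ = suppCutoff x₀ ρ` (`= 1` on `B̄(x₀, ρ)`,
supported in `B̄(x₀, 2ρ)`) and every `x` with `‖x − x₀‖ ≤ ρ`:
`v(x) = (K ∗ curl(φv))(x) + ∑ⱼ (∫ ∂ⱼΓ(x − y) ⟪v(y), ∇φ(y)⟫ dy) eⱼ`. This is the tree's
`eq_biotSavart_curl_suppCutoff_smul_add` (there `x = x₀`) with the same proof — `K ∗ Φ = −Γ ∗ curl Φ`
for `Φ = curl(φv)`, `curl curl = ∇ div − Δ`, Green's representation `Γ ∗ Δ(φv) = φv` evaluated at a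
point where `φ = 1`, the weak gradient of `Γ`, and `div(φv) = ⟪v, ∇φ⟫`.
[cite: MajdaBertozziCUP2002, §2.4.1 Prop. 2.16 (2.92)–(2.95)] -/
theorem eq_biotSavart_curl_suppCutoff_smul_add_of_norm_sub_le (hv : ContDiff ℝ 2 v)
    (hdiv : VectorCalculus.IsDivFree v) {ρ : ℝ} (hρ : 0 < ρ) (x₀ : (EuclideanSpace ℝ (Fin 3)))
    {x : (EuclideanSpace ℝ (Fin 3))} (hx : ‖x - x₀‖ ≤ ρ) :
    v x = biotSavart (curl fun y => suppCutoff x₀ ρ y • v y) x +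
      ∑ j, (∫ y, fderiv ℝ newtonKernel (x - y) (EuclideanSpace.single (j : Fin 3) (1 : ℝ)) *
        ⟪v y, gradient (suppCutoff x₀ ρ) y⟫) • (EuclideanSpace.single (j : Fin 3) (1 : ℝ)) := by
  -- adapted from Literature/Analysis/FluidPDE/BiotSavartRepresentationSqIntegrable.lean
  -- (`eq_biotSavart_curl_suppCutoff_smul_add`), cutoff centre `x₀` decoupled from the point `x`
  set φ : (EuclideanSpace ℝ (Fin 3)) → ℝ := suppCutoff x₀ ρ with hφdef
  have hφ2 : ContDiff ℝ 2 φ := contDiff_suppCutoff x₀ ρ (n := 2)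
  have hφc : HasCompactSupport φ := hasCompactSupport_suppCutoff x₀ hρ
  set W : (EuclideanSpace ℝ (Fin 3)) → (EuclideanSpace ℝ (Fin 3)) := fun y => φ y • v y with hWdef
  have hW : ContDiff ℝ 2 W := hφ2.smul hv
  have hWc : HasCompactSupport W := hφc.smul_right
  have hcW : ContDiff ℝ 1 (curl W) := contDiff_curl (n := 1) (by exact hW)
  have hcWc : HasCompactSupport (curl W) := hasCompactSupport_curl hWc
  have hccWc : HasCompactSupport (curl (curl W)) := hasCompactSupport_curl hcWc
  have hccW : Continuous (curl (curl W)) := continuous_curl hcW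
  -- `div W = ⟪v, ∇φ⟫`
  set f : (EuclideanSpace ℝ (Fin 3)) → ℝ := fun y => ⟪v y, gradient φ y⟫ with hfdef
  have hdivW : VectorCalculus.divergence W = f := by
    funext y
    rw [hWdef, divergence_smul_apply (hφ2.differentiable (by norm_num) y)
      (hv.differentiable (by norm_num) y), hdiv y, mul_zero, zero_add]
  have hv1 : ContDiff ℝ 1 v := hv.of_le (by norm_num)
  have hf1 : ContDiff ℝ 1 f := ContDiff.inner ℝ hv1 (contDiff_gradient_suppCutoff_scale x₀ ρ)
  have hfc : HasCompactSupport f := by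
    refine (hasCompactSupport_gradient_suppCutoff_scale x₀ hρ).mono ?_
    intro y hy
    rw [mem_support] at hy ⊢
    intro h
    have h' : gradient φ y = 0 := by rw [hφdef]; exact h
    exact hy (show ⟪v y, gradient φ y⟫ = 0 by rw [h', inner_zero_right])
  -- the Laplacian
  have hΔc : Continuous (Δ W) := (contDiff_laplacian (n := 0) (by exact hW)).continuous
  have hΔs : HasCompactSupport (Δ W) :=
    HasCompactSupport.of_support_subset_isCompact hWc.isCompact fun y hy => by
      by_contra h
      exact hy (laplacian_eq_zero_of_notMem_tsupport h)
  -- `curl curl W = G − ΔW`, `G = ∑ᵢ ∂ᵢ f eᵢ`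
  set G : (EuclideanSpace ℝ (Fin 3)) → (EuclideanSpace ℝ (Fin 3)) := fun y =>
    ∑ i, (fderiv ℝ f y (EuclideanSpace.single (i : Fin 3) (1 : ℝ))) •
      (EuclideanSpace.single (i : Fin 3) (1 : ℝ)) with hGdef
  have hccW_eq : ∀ y, curl (curl W) y = G y - (Δ W) y := fun y => by
    rw [curl_curl_eq_sum_fderiv_divergence_sub_laplacian hW y, hdivW]
  -- integrability against `Γ(x − ·)`
  have IΔ : Integrable fun y => newtonKernel (x - y) • (Δ W) y :=
    integrable_newtonKernel_smul hΔc hΔs x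
  have Icc : Integrable fun y => newtonKernel (x - y) • curl (curl W) y :=
    integrable_newtonKernel_smul hccW hccWc x
  have IG : Integrable fun y => newtonKernel (x - y) • G y := by
    have h := Icc.add IΔ
    refine h.congr (Eventually.of_forall fun y => ?_)
    show newtonKernel (x - y) • curl (curl W) y + newtonKernel (x - y) • (Δ W) y = _
    rw [hccW_eq, smul_sub, sub_add_cancel]
  have Ii : ∀ i : Fin 3, Integrable fun y =>
      newtonKernel (x - y) * fderiv ℝ f y (EuclideanSpace.single (i : Fin 3) (1 : ℝ)) := fun i => by
    have h := integrable_newtonKernel_smul (F := ℝ)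
      ((hf1.continuous_fderiv one_ne_zero).clm_apply continuous_const)
      (hfc.fderiv_apply (𝕜 := ℝ) (EuclideanSpace.single (i : Fin 3) (1 : ℝ))) x
    simpa only [smul_eq_mul] using h
  -- `∫ Γ • G = ∑ⱼ (∫ ∂ⱼΓ(x − y) f(y)) eⱼ`
  have hG : ∫ y, newtonKernel (x - y) • G y =
      ∑ j, (∫ y, fderiv ℝ newtonKernel (x - y) (EuclideanSpace.single (j : Fin 3) (1 : ℝ)) * f y) •
        (EuclideanSpace.single (j : Fin 3) (1 : ℝ)) := by
    have hexp : (fun y => newtonKernel (x - y) • G y) =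
        fun y => ∑ j, (newtonKernel (x - y) *
          fderiv ℝ f y (EuclideanSpace.single (j : Fin 3) (1 : ℝ))) •
            (EuclideanSpace.single (j : Fin 3) (1 : ℝ)) := by
      funext y
      rw [hGdef, Finset.smul_sum]
      refine Finset.sum_congr rfl fun j _ => ?_
      rw [smul_smul]
    rw [hexp, integral_finsetSum _ fun j _ => (Ii j).smul_const _]
    refine Finset.sum_congr rfl fun j _ => ?_
    rw [integral_smul_const]
    congr 1
    have h := integral_newtonKernel_smul_fderiv_eq (F := ℝ) hf1 hfc x
      (EuclideanSpace.single (j : Fin 3) (1 : ℝ))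
    simpa only [smul_eq_mul] using h
  -- Green, read off at `x` where `φ x = 1`
  have hGreen : ∫ y, newtonKernel (x - y) • (Δ W) y = v x := by
    rw [integral_newtonKernel_smul_laplacian hW hWc x, hWdef]
    simp only [hφdef, suppCutoff_eq_one hρ hx, one_smul]
  -- assemble
  have h1 := biotSavart_eq_neg_integral_newtonKernel_smul_curl hcW hcWc x
  have h2 : ∫ y, newtonKernel (x - y) • curl (curl W) y =
      (∫ y, newtonKernel (x - y) • G y) - ∫ y, newtonKernel (x - y) • (Δ W) y := by
    rw [← integral_sub IG IΔ]
    refine integral_congr_ae (Eventually.of_forall fun y => ?_)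
    show newtonKernel (x - y) • curl (curl W) y =
      newtonKernel (x - y) • G y - newtonKernel (x - y) • (Δ W) y
    rw [hccW_eq, smul_sub]
  rw [h1, h2, hGreen, hG]
  abel

end Representation

/-! ### Tools: kernel differences on the cutoff shell; the `C ∩ L²` majorant -/

section Tools

variable {V W : Type*} [NormedAddCommGroup V] [NormedSpace ℝ V] [NormedAddCommGroup W]
  [NormedSpace ℝ W]

/-- **Kernel differences against a shell density.** Let `K` be a `C¹` singular kernel of degree `−2`
with constant `A`, `B` the universal cutoff constant (`‖∇(radialCutoff ε 2ε)‖ ≤ Bε⁻¹`), `x, x̄` two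
points with `‖x − x̄‖ ≤ ρ`, `ξ` their midpoint and `φ = suppCutoff ξ ρ`. If the density `g` obeys
`‖g(y)‖ ≤ ‖∇φ(y)‖ · M` (so it lives on the shell `ρ ≤ |y − ξ| ≤ 2ρ`, where
`‖K(x − y) − K(x̄ − y)‖ ≤ A((|ξ − y|/2)³)⁻¹‖x − x̄‖ ≤ 8A‖x − x̄‖ρ⁻³`, `norm_kernel_sub_kernel_le`), then
pointwise `‖(K(x − y) − K(x̄ − y)) g(y)‖ ≤ 8 A ‖x − x̄‖ B M ρ⁻⁴ · 1_{B̄(ξ, 2ρ)}(y)`. [folklore] -/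
theorem norm_kernel_sub_kernel_apply_shell_le {K : (EuclideanSpace ℝ (Fin 3)) → V →L[ℝ] W} {A : ℝ}
    (hK : IsC1SingularKernel K A) {B : ℝ}
    (hB : ∀ ε : ℝ, 0 < ε → ∀ z : EuclideanSpace ℝ (Fin 3),
      ‖fderiv ℝ (radialCutoff ε (2 * ε)) z‖ ≤ B * ε⁻¹)
    (hB0 : 0 ≤ B) {x x' : EuclideanSpace ℝ (Fin 3)} {ρ : ℝ} (hρ : 0 < ρ) (hxx' : ‖x - x'‖ ≤ ρ)
    {g : (EuclideanSpace ℝ (Fin 3)) → V} {M : ℝ} (hM0 : 0 ≤ M)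
    (hg : ∀ y, ‖g y‖ ≤ ‖fderiv ℝ (suppCutoff (mid x x') ρ) y‖ * M) (y : EuclideanSpace ℝ (Fin 3)) :
    ‖(K (x - y) - K (x' - y)) (g y)‖ ≤
      8 * A * ‖x - x'‖ * B * M * (ρ ^ 4)⁻¹ *
        (closedBall (mid x x') (2 * ρ)).indicator (fun _ => (1 : ℝ)) y := by
  have hA := hK.nonneg
  have hind0 : 0 ≤ (closedBall (mid x x') (2 * ρ)).indicator (fun _ => (1 : ℝ)) y :=
    indicator_nonneg (fun _ _ => zero_le_one) y
  have hrhs0 : 0 ≤ 8 * A * ‖x - x'‖ * B * M * (ρ ^ 4)⁻¹ *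
      (closedBall (mid x x') (2 * ρ)).indicator (fun _ => (1 : ℝ)) y := by positivity
  -- the basic operator bound
  have hop : ‖(K (x - y) - K (x' - y)) (g y)‖ ≤
      ‖K (x - y) - K (x' - y)‖ * (‖fderiv ℝ (suppCutoff (mid x x') ρ) y‖ * M) :=
    (ContinuousLinearMap.le_opNorm _ _).trans (mul_le_mul_of_nonneg_left (hg y) (norm_nonneg _))
  by_cases h1 : ‖y - mid x x'‖ < ρ
  · -- inside the inner ball the cutoff is constant: `∇φ = 0`
    rw [fderiv_suppCutoff_eq_zero hρ h1, norm_zero, zero_mul, mul_zero] at hop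
    exact hop.trans hrhs0
  by_cases h2 : 2 * ρ < ‖y - mid x x'‖
  · -- outside the outer ball the cutoff vanishes identically: `∇φ = 0`
    rw [fderiv_suppCutoff_eq_zero_of_lt hρ h2, norm_zero, zero_mul, mul_zero] at hop
    exact hop.trans hrhs0
  · -- on the shell
    have hyin : ρ ≤ ‖y - mid x x'‖ := not_lt.1 h1
    have hy2 : y ∈ closedBall (mid x x') (2 * ρ) := by
      rw [mem_closedBall, dist_eq_norm]; exact not_lt.1 h2
    rw [indicator_of_mem hy2, mul_one]
    have hker : ‖K (x - y) - K (x' - y)‖ ≤ A * ((‖mid x x' - y‖ / 2) ^ 3)⁻¹ * ‖x - x'‖ :=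
      norm_kernel_sub_kernel_le hK hρ hxx' hyin
    have hm : ρ / 2 ≤ ‖mid x x' - y‖ / 2 := by rw [norm_sub_rev]; linarith
    have hker' : ‖K (x - y) - K (x' - y)‖ ≤ A * ((ρ / 2) ^ 3)⁻¹ * ‖x - x'‖ := by
      refine hker.trans (mul_le_mul_of_nonneg_right (mul_le_mul_of_nonneg_left ?_ hA) (norm_nonneg _))
      exact inv_anti₀ (by positivity) (pow_le_pow_left₀ (by positivity) hm 3)
    have hDφ : ‖fderiv ℝ (suppCutoff (mid x x') ρ) y‖ ≤ B * ρ⁻¹ :=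
      norm_fderiv_suppCutoff_le hB (mid x x') hρ y
    calc ‖(K (x - y) - K (x' - y)) (g y)‖
        ≤ ‖K (x - y) - K (x' - y)‖ * (‖fderiv ℝ (suppCutoff (mid x x') ρ) y‖ * M) := hop
      _ ≤ (A * ((ρ / 2) ^ 3)⁻¹ * ‖x - x'‖) * ((B * ρ⁻¹) * M) := by
          refine mul_le_mul hker' (mul_le_mul_of_nonneg_right hDφ hM0) (by positivity) (by positivity)
      _ = 8 * A * ‖x - x'‖ * B * M * (ρ ^ 4)⁻¹ := by
          field_simp
          ring

/-- **Integrated form**: under the hypotheses of `norm_kernel_sub_kernel_apply_shell_le`,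
`‖∫ (K(x − y) − K(x̄ − y)) g(y) dy‖ ≤ 64 A B M |B₁| ‖x − x̄‖ ρ⁻¹` (`|B̄(ξ, 2ρ)| = 8ρ³|B₁|`,
`Measure.addHaar_closedBall`). [folklore] -/
theorem norm_integral_kernel_sub_kernel_apply_shell_le [CompleteSpace W]
    {K : (EuclideanSpace ℝ (Fin 3)) → V →L[ℝ] W} {A : ℝ}
    (hK : IsC1SingularKernel K A) {B : ℝ}
    (hB : ∀ ε : ℝ, 0 < ε → ∀ z : EuclideanSpace ℝ (Fin 3),
      ‖fderiv ℝ (radialCutoff ε (2 * ε)) z‖ ≤ B * ε⁻¹)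
    (hB0 : 0 ≤ B) {x x' : EuclideanSpace ℝ (Fin 3)} {ρ : ℝ} (hρ : 0 < ρ) (hxx' : ‖x - x'‖ ≤ ρ)
    {g : (EuclideanSpace ℝ (Fin 3)) → V} {M : ℝ} (hM0 : 0 ≤ M)
    (hg : ∀ y, ‖g y‖ ≤ ‖fderiv ℝ (suppCutoff (mid x x') ρ) y‖ * M) :
    ‖∫ y, (K (x - y) - K (x' - y)) (g y)‖ ≤
      64 * A * B * M * (volume (ball (0 : EuclideanSpace ℝ (Fin 3)) 1)).toReal * ‖x - x'‖ * ρ⁻¹ := by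
  set V₁ : ℝ := (volume (ball (0 : EuclideanSpace ℝ (Fin 3)) 1)).toReal with hV₁
  set χ : EuclideanSpace ℝ (Fin 3) → ℝ :=
    (closedBall (mid x x') (2 * ρ)).indicator (fun _ => (1 : ℝ)) with hχ
  have hχi : Integrable χ := by
    rw [hχ, integrable_indicator_iff measurableSet_closedBall]
    exact integrableOn_const measure_closedBall_lt_top.ne
  have hvol : ∫ y, χ y = (2 * ρ) ^ 3 * V₁ := by
    rw [hχ, integral_indicator_const _ measurableSet_closedBall, smul_eq_mul, mul_one,
      measureReal_def, Measure.addHaar_closedBall _ _ (by positivity), ENNReal.toReal_mul,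
      finrank_euclideanSpace_fin, ENNReal.toReal_ofReal (by positivity)]
  set c : ℝ := 8 * A * ‖x - x'‖ * B * M * (ρ ^ 4)⁻¹ with hc
  have hmaj : Integrable fun y => c * χ y := hχi.const_mul c
  have hpt : ∀ y, ‖(K (x - y) - K (x' - y)) (g y)‖ ≤ c * χ y := fun y =>
    norm_kernel_sub_kernel_apply_shell_le hK hB hB0 hρ hxx' hM0 hg y
  refine (norm_integral_le_of_norm_le hmaj (Eventually.of_forall hpt)).trans ?_
  rw [integral_const_mul, hvol, hc]
  have hρ0 : ρ ≠ 0 := hρ.ne'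
  field_simp
  ring_nf
  exact le_rfl

/-- **The dominating function of the Biot–Savart integrand for `ω ∈ C ∩ L²`.** For `ω` continuous
with `∫‖ω‖² < ∞` and any `x`, `y ↦ (4π)⁻¹ ‖ω(y)‖ |x − y|⁻²` is integrable: near `x` it is at most
`(4π)⁻¹ (sup_{B̄(x,1)}‖ω‖) |x − y|⁻²` (`kernelMajorant`), and away from `x` at most
`((4π)⁻¹/2)(‖ω(y)‖² + |x − y|⁻⁴ 1_{|x−y| ≥ 1})` (`memLp_two_farKernel`). [folklore] -/
theorem integrable_norm_mul_inv_sq {w : EuclideanSpace ℝ (Fin 3) → EuclideanSpace ℝ (Fin 3)}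
    (hωc : Continuous w) (hω2 : Integrable fun y => ‖w y‖ ^ 2) (x : EuclideanSpace ℝ (Fin 3)) :
    Integrable fun y => (4 * π)⁻¹ * ‖w y‖ * (‖x - y‖ ^ 2)⁻¹ := by
  -- adapted from Literature/Analysis/FluidPDE/BiotSavartRepresentationSqIntegrable.lean (private there)
  obtain ⟨M, hM⟩ := (isCompact_closedBall x 1).exists_bound_of_continuousOn hωc.continuousOn
  have hM0 : 0 ≤ M := (norm_nonneg _).trans (hM x (mem_closedBall_self zero_le_one))
  set kf : EuclideanSpace ℝ (Fin 3) → ℝ := fun z =>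
    (ball (0 : EuclideanSpace ℝ (Fin 3)) 1)ᶜ.indicator (fun z => (‖z‖ ^ 2)⁻¹) z with hkf
  have hkf0 : ∀ z, 0 ≤ kf z := fun z => by
    rw [hkf]; exact indicator_nonneg (fun _ _ => by positivity) z
  have hkf2 : Integrable fun z => kf z ^ 2 := by
    have h := memLp_two_farKernel
    have h2 : ENNReal.ofReal 2 = (2 : ℝ≥0∞) := by norm_num
    rw [h2, memLp_two_iff_integrable_sq_norm h.1] at h
    refine h.congr (Eventually.of_forall fun z => ?_)
    show ‖kf z‖ ^ 2 = kf z ^ 2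
    rw [Real.norm_of_nonneg (hkf0 z)]
  have hkf2x : Integrable fun y => kf (x - y) ^ 2 := hkf2.comp_sub_left x
  set g : EuclideanSpace ℝ (Fin 3) → ℝ := fun y =>
    (4 * π)⁻¹ * M * kernelMajorant 1 (x - y) +
      (4 * π)⁻¹ / 2 * (‖w y‖ ^ 2 + kf (x - y) ^ 2) with hg
  have hgi : Integrable g := by
    rw [hg]
    exact (((integrable_kernelMajorant 1).comp_sub_left x).const_mul _).add
      ((hω2.add hkf2x).const_mul _)
  have hmeas : AEStronglyMeasurable (fun y => (4 * π)⁻¹ * ‖w y‖ * (‖x - y‖ ^ 2)⁻¹) volume := by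
    refine ((continuous_const.mul hωc.norm).measurable.mul ?_).aestronglyMeasurable
    exact ((continuous_const.sub continuous_id).norm.pow 2).measurable.inv
  refine hgi.mono' hmeas (Eventually.of_forall fun y => ?_)
  rw [Real.norm_of_nonneg (by positivity)]
  have hπ : 0 < (4 * π)⁻¹ := by positivity
  by_cases hy : ‖x - y‖ < 1
  · have hmem : x - y ∈ ball (0 : EuclideanSpace ℝ (Fin 3)) 1 := by rwa [mem_ball_zero_iff]
    have hk : kernelMajorant 1 (x - y) = (‖x - y‖ ^ 2)⁻¹ := by
      rw [kernelMajorant, indicator_of_mem hmem]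
    have hyM : ‖w y‖ ≤ M := hM y (by rw [mem_closedBall, dist_eq_norm, norm_sub_rev]; exact hy.le)
    have hfar0 : 0 ≤ (4 * π)⁻¹ / 2 * (‖w y‖ ^ 2 + kf (x - y) ^ 2) := by positivity
    calc (4 * π)⁻¹ * ‖w y‖ * (‖x - y‖ ^ 2)⁻¹ ≤ (4 * π)⁻¹ * M * (‖x - y‖ ^ 2)⁻¹ := by
          gcongr
      _ = (4 * π)⁻¹ * M * kernelMajorant 1 (x - y) := by rw [hk]
      _ ≤ g y := by rw [hg]; linarith
  · have hmem : x - y ∈ (ball (0 : EuclideanSpace ℝ (Fin 3)) 1)ᶜ := by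
      rw [mem_compl_iff, mem_ball_zero_iff]; exact hy
    have hk : kf (x - y) = (‖x - y‖ ^ 2)⁻¹ := by rw [hkf]; exact indicator_of_mem hmem _
    have hnear0 : 0 ≤ (4 * π)⁻¹ * M * kernelMajorant 1 (x - y) :=
      mul_nonneg (by positivity) (kernelMajorant_nonneg _ _)
    have hamgm : ‖w y‖ * (‖x - y‖ ^ 2)⁻¹ ≤ (‖w y‖ ^ 2 + kf (x - y) ^ 2) / 2 := by
      rw [← hk]
      nlinarith [sq_nonneg (‖w y‖ - kf (x - y))]
    calc (4 * π)⁻¹ * ‖w y‖ * (‖x - y‖ ^ 2)⁻¹ = (4 * π)⁻¹ * (‖w y‖ * (‖x - y‖ ^ 2)⁻¹) := by ring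
      _ ≤ (4 * π)⁻¹ * ((‖w y‖ ^ 2 + kf (x - y) ^ 2) / 2) := mul_le_mul_of_nonneg_left hamgm hπ.le
      _ = (4 * π)⁻¹ / 2 * (‖w y‖ ^ 2 + kf (x - y) ^ 2) := by ring
      _ ≤ g y := by rw [hg]; linarith

/-- **The cut-off Biot–Savart integrals converge**: for `ω ∈ C ∩ L²`, any centre `ξ`, any point `z`
and scales `ρₙ ≥ n + 1`, `∫ K₃(z − y) (suppCutoff ξ ρₙ y) ω(y) dy → (K₃ ∗ ω)(z)` (dominated
convergence: the integrand is eventually constant in `n` at every `y`, dominated by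
`(4π)⁻¹‖ω(y)‖|z − y|⁻²`). [folklore] -/
theorem tendsto_integral_biotSavartKernel_suppCutoff_smul
    {w : EuclideanSpace ℝ (Fin 3) → EuclideanSpace ℝ (Fin 3)}
    (hωc : Continuous w) (hω2 : Integrable fun y => ‖w y‖ ^ 2) (ξ z : EuclideanSpace ℝ (Fin 3))
    {ρ : ℕ → ℝ} (hρ0 : ∀ n, 0 < ρ n) (hρn : ∀ n : ℕ, (n : ℝ) + 1 ≤ ρ n) :
    Tendsto (fun n => ∫ y, biotSavartKernel (z - y) (suppCutoff ξ (ρ n) y • w y)) atTop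
      (𝓝 (biotSavart w z)) := by
  rw [biotSavart]
  refine tendsto_integral_of_dominated_convergence (fun y => (4 * π)⁻¹ * ‖w y‖ * (‖z - y‖ ^ 2)⁻¹)
    (fun n => ?_) (integrable_norm_mul_inv_sq hωc hω2 z) (fun n => Eventually.of_forall fun y => ?_)
    (Eventually.of_forall fun y => ?_)
  · exact (measurable_biotSavartKernel_sub_apply
      (((contDiff_suppCutoff ξ (ρ n) (n := 1)).continuous.smul hωc).measurable) z).aestronglyMeasurable
  · calc ‖biotSavartKernel (z - y) (suppCutoff ξ (ρ n) y • w y)‖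
        ≤ (4 * π)⁻¹ * ‖suppCutoff ξ (ρ n) y • w y‖ * (‖z - y‖ ^ 2)⁻¹ := norm_biotSavartKernel_le _ _
      _ ≤ (4 * π)⁻¹ * ‖w y‖ * (‖z - y‖ ^ 2)⁻¹ := by
          gcongr
          rw [norm_smul, Real.norm_eq_abs]
          exact mul_le_of_le_one_left (norm_nonneg _) (abs_suppCutoff_le_one ξ (ρ n) y)
  · refine tendsto_const_nhds.congr' ?_
    obtain ⟨N, hN⟩ := exists_nat_ge ‖y - ξ‖
    refine eventually_atTop.2 ⟨N, fun n hn => ?_⟩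
    have hle : ‖y - ξ‖ ≤ ρ n := by
      calc ‖y - ξ‖ ≤ (N : ℝ) := hN
        _ ≤ (n : ℝ) := by exact_mod_cast hn
        _ ≤ (n : ℝ) + 1 := by linarith
        _ ≤ ρ n := hρn n
    show biotSavartKernel (z - y) (w y) = biotSavartKernel (z - y) (suppCutoff ξ (ρ n) y • w y)
    simp only [suppCutoff_eq_one (hρ0 n) hle, one_smul]

end Tools

end Summit.NavierStokesRegularity.NavierStokesRegularity.Theorems.DepletionLadder.BoundedBiotSavart

end
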